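import Literature.NumberTheory.LFunctions.DirichletLTruncationCertificates
import HarnessLib

/-!
# Fixed-point root chains for packed truncation certificates

The packed truncation certificates (Chua's ALGO 1 on a graded mesh `s₀ = i/E`, `E = 2^J`) need rigorous fixed-point enclosures of
`2^P · x^{-i/E}` at the block nodes `x`. They are produced from the enclosure `rootEnc x 2 P` of `2^P x^{-1/2}` by a chain of CHECKED
integer square roots (`ℓ_{k+1}² ≤ 2^P ℓ_k`, `2^P u_k ≤ u_{k+1}²`), giving `ℓ_e ≤ 2^P x^{-2^e/E} ≤ u_e` for `e < J`, and then multiplied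
together along the binary digits of the step `Δ = i − i_prev` (`stepLo` rounding down, `stepHi` rounding up). This file contains these
definitions and their enclosure theorems. [cite: Chua2005RealZeros, §2.2 ALGO 1]
-/

namespace Literature.NumberTheory.LFunctions

namespace LTruncationPacked

open LTruncationCert

/-! ### Checked integer square roots -/

/-- Newton candidate for `⌊√X⌋` from a start `g` (fuel-bounded heuristic; only used through the checks below). [folklore] -/
def newtonSqrt (X : ℕ) : ℕ → ℕ → ℕ
  | 0, g => g
  | fuel + 1, g =>
    let g' := (g + X / g) / 2
    bif Nat.blt g' g then newtonSqrt X fuel g' else g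

/-- A CHECKED lower square root: some `r` with `r² ≤ X` (`0` if the candidate fails). [folklore] -/
def lowSqrt (X g : ℕ) : ℕ :=
  let c := newtonSqrt X 40 g
  bif Nat.ble (c * c) X then c else bif Nat.ble ((c - 1) * (c - 1)) X then c - 1 else 0

/-- A CHECKED upper square root: some `r` with `X ≤ r²`. [folklore] -/
def upSqrt (X g : ℕ) : ℕ :=
  let c := newtonSqrt X 40 g
  bif Nat.ble X (c * c) then c else bif Nat.ble X ((c + 1) * (c + 1)) then c + 1 else X + 1

/-- `(lowSqrt X g)² ≤ X` (the rigorous rounding step for lower root values). [cite: Chua2005RealZeros, §2.2 ALGO 1] -/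
theorem lowSqrt_mul_self_le (X g : ℕ) : lowSqrt X g * lowSqrt X g ≤ X := by
  unfold lowSqrt
  simp only
  cases h1 : Nat.ble (newtonSqrt X 40 g * newtonSqrt X 40 g) X
  · cases h2 : Nat.ble ((newtonSqrt X 40 g - 1) * (newtonSqrt X 40 g - 1)) X
    · simp
    · simpa using Nat.le_of_ble_eq_true h2
  · simpa using Nat.le_of_ble_eq_true h1

/-- `X ≤ (upSqrt X g)²` (the rigorous rounding step for upper root values). [cite: Chua2005RealZeros, §2.2 ALGO 1] -/
theorem le_upSqrt_mul_self (X g : ℕ) : X ≤ upSqrt X g * upSqrt X g := by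
  unfold upSqrt
  simp only
  cases h1 : Nat.ble X (newtonSqrt X 40 g * newtonSqrt X 40 g)
  · cases h2 : Nat.ble X ((newtonSqrt X 40 g + 1) * (newtonSqrt X 40 g + 1))
    · simp only [cond_false]; nlinarith
    · simpa using Nat.le_of_ble_eq_true h2
  · simpa using Nat.le_of_ble_eq_true h1

/-! ### The root chains -/

/-- Lower root chain: from `ℓ` (head of `acc`) prepend `k` further levels `ℓ' = lowSqrt (2^P ℓ)`; deepest level first.
[cite: Chua2005RealZeros, §2.2 ALGO 1] -/
def lowChain (P : ℕ) : ℕ → ℕ → List ℕ → List ℕ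
  | 0, _, acc => acc
  | k + 1, ℓ, acc => let ℓ' := lowSqrt (ℓ <<< P) ((ℓ + (1 <<< P)) / 2); lowChain P k ℓ' (ℓ' :: acc)

/-- Upper root chain (see `lowChain`): `u' = upSqrt (2^P u)`. [cite: Chua2005RealZeros, §2.2 ALGO 1] -/
def upChain (P : ℕ) : ℕ → ℕ → List ℕ → List ℕ
  | 0, _, acc => acc
  | k + 1, u, acc => let u' := upSqrt (u <<< P) ((u + (1 <<< P)) / 2 + 1); upChain P k u' (u' :: acc)

/-- Lower roots of `x`: index `e < J` ↦ some `ℓ ≤ 2^P x^{-2^e/2^J}`; built from `(rootEnc x 2 P).1 ≤ 2^P x^{-1/2}`.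
[cite: Chua2005RealZeros, §2.2 ALGO 1] -/
def lowRoots (P J x : ℕ) : List ℕ := lowChain P (J - 1) (rootEnc x 2 P).1 [(rootEnc x 2 P).1]

/-- Upper roots of `x`: index `e < J` ↦ some `u ≥ 2^P x^{-2^e/2^J}`. [cite: Chua2005RealZeros, §2.2 ALGO 1] -/
def upRoots (P J x : ℕ) : List ℕ := upChain P (J - 1) (rootEnc x 2 P).2 [(rootEnc x 2 P).2]

/-- Chain step DOWN by `Δ` numerator units: multiply by the root of index `e` for every set bit `e` of `Δ` (starting at bit/index `e`),
rescaling (rounding down) after each product; a missing root gives `0`. [cite: Chua2005RealZeros, §2.2 ALGO 1] -/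
def stepLo (P : ℕ) (roots : List ℕ) : ℕ → ℕ → ℕ → ℕ → ℕ
  | 0, c, Δ, _ => bif Nat.beq Δ 0 then c else 0
  | fuel + 1, c, Δ, e =>
    bif Nat.beq Δ 0 then c else
    let c' := bif Nat.beq (Δ % 2) 1 then (c * roots.getD e 0) >>> P else c
    stepLo P roots fuel c' (Δ / 2) (e + 1)

/-- Chain step UP by `Δ` (see `stepLo`; rounding up; a missing root yields `2^{3P}`). [cite: Chua2005RealZeros, §2.2 ALGO 1] -/
def stepHi (P : ℕ) (roots : List ℕ) : ℕ → ℕ → ℕ → ℕ → ℕ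
  | 0, c, Δ, _ => bif Nat.beq Δ 0 then c else 1 <<< (3 * P)
  | fuel + 1, c, Δ, e =>
    bif Nat.beq Δ 0 then c else
    let c' := bif Nat.beq (Δ % 2) 1 then (c * roots.getD e (1 <<< (3 * P)) + ((1 <<< P) - 1)) >>> P else c
    stepHi P roots fuel c' (Δ / 2) (e + 1)

/-! ### Enclosure theorems -/

section Specs

variable {x : ℕ} (P : ℕ)

/-- The lower-root property of a list: entry `e` is `≤ 2^P x^{-2^e/2^D}`. [cite: Chua2005RealZeros, §2.2 ALGO 1] -/
def RootsLow (P x D : ℕ) (l : List ℕ) : Prop :=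
  ∀ e, e < l.length → ((l.getD e 0 : ℕ) : ℝ) ≤ (2 : ℝ) ^ P * (x : ℝ) ^ (-((2 : ℝ) ^ e / (2 : ℝ) ^ D))

/-- The upper-root property of a list: entry `e` is `≥ 2^P x^{-2^e/2^D}`. [cite: Chua2005RealZeros, §2.2 ALGO 1] -/
def RootsUp (P x D : ℕ) (l : List ℕ) : Prop :=
  ∀ e, e < l.length → (2 : ℝ) ^ P * (x : ℝ) ^ (-((2 : ℝ) ^ e / (2 : ℝ) ^ D)) ≤ ((l.getD e (1 <<< (3 * P)) : ℕ) : ℝ)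

/-- Exponent bookkeeping: `2^{e+1}/2^{D+1} = 2^e/2^D`. [folklore] -/
private theorem two_pow_succ_div_succ (e D : ℕ) :
    (2 : ℝ) ^ (e + 1) / (2 : ℝ) ^ (D + 1) = (2 : ℝ) ^ e / (2 : ℝ) ^ D := by
  rw [pow_succ, pow_succ, mul_div_mul_right _ _ (by norm_num)]

/-- The square of `x^{-1/2^{D+1}}` is `x^{-1/2^D}` (`x > 0`). [folklore] -/
private theorem rpow_half_sq {y : ℝ} (hy : 0 < y) (D : ℕ) :
    (y ^ (-((2 : ℝ) ^ (0 : ℕ) / (2 : ℝ) ^ (D + 1)))) ^ 2 = y ^ (-((2 : ℝ) ^ (0 : ℕ) / (2 : ℝ) ^ D)) := by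
  rw [← Real.rpow_natCast, ← Real.rpow_mul hy.le]
  congr 1
  rw [pow_succ]; push_cast; field_simp

/-- One lower step: `ℓ'² ≤ 2^P ℓ`, `ℓ ≤ 2^P x^{-1/2^D}` ⇒ `ℓ' ≤ 2^P x^{-1/2^{D+1}}`. [cite: Chua2005RealZeros, §2.2 ALGO 1] -/
theorem low_step {ℓ ℓ' : ℕ} {D : ℕ} (hx : 1 ≤ x) (hsq : ℓ' * ℓ' ≤ ℓ <<< P)
    (hℓ : (ℓ : ℝ) ≤ (2 : ℝ) ^ P * (x : ℝ) ^ (-((2 : ℝ) ^ (0 : ℕ) / (2 : ℝ) ^ D))) :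
    (ℓ' : ℝ) ≤ (2 : ℝ) ^ P * (x : ℝ) ^ (-((2 : ℝ) ^ (0 : ℕ) / (2 : ℝ) ^ (D + 1))) := by
  have hx0 : (0 : ℝ) < x := by exact_mod_cast hx
  set y : ℝ := (x : ℝ) ^ (-((2 : ℝ) ^ (0 : ℕ) / (2 : ℝ) ^ (D + 1))) with hy
  have hy0 : 0 < y := Real.rpow_pos_of_pos hx0 _
  have hsq' : ((ℓ' : ℝ)) ^ 2 ≤ (2 : ℝ) ^ P * ℓ := by
    rw [Nat.shiftLeft_eq] at hsq
    have : ((ℓ' * ℓ' : ℕ) : ℝ) ≤ ((ℓ * 2 ^ P : ℕ) : ℝ) := by exact_mod_cast hsq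
    push_cast at this; nlinarith
  have h2 : ((ℓ' : ℝ)) ^ 2 ≤ ((2 : ℝ) ^ P * y) ^ 2 := by
    calc ((ℓ' : ℝ)) ^ 2 ≤ (2 : ℝ) ^ P * ℓ := hsq'
      _ ≤ (2 : ℝ) ^ P * ((2 : ℝ) ^ P * (x : ℝ) ^ (-((2 : ℝ) ^ (0 : ℕ) / (2 : ℝ) ^ D))) :=
          mul_le_mul_of_nonneg_left hℓ (by positivity)
      _ = ((2 : ℝ) ^ P * y) ^ 2 := by rw [mul_pow, hy, rpow_half_sq hx0 D]; ring
  exact (pow_le_pow_iff_left₀ (by positivity) (by positivity) (by norm_num : (2 : ℕ) ≠ 0)).1 h2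

/-- One upper step: `2^P u ≤ u'²`, `2^P x^{-1/2^D} ≤ u` ⇒ `2^P x^{-1/2^{D+1}} ≤ u'`. [cite: Chua2005RealZeros, §2.2 ALGO 1] -/
theorem up_step {u u' : ℕ} {D : ℕ} (hx : 1 ≤ x) (hsq : u <<< P ≤ u' * u')
    (hu : (2 : ℝ) ^ P * (x : ℝ) ^ (-((2 : ℝ) ^ (0 : ℕ) / (2 : ℝ) ^ D)) ≤ u) :
    (2 : ℝ) ^ P * (x : ℝ) ^ (-((2 : ℝ) ^ (0 : ℕ) / (2 : ℝ) ^ (D + 1))) ≤ u' := by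
  have hx0 : (0 : ℝ) < x := by exact_mod_cast hx
  set y : ℝ := (x : ℝ) ^ (-((2 : ℝ) ^ (0 : ℕ) / (2 : ℝ) ^ (D + 1))) with hy
  have hy0 : 0 < y := Real.rpow_pos_of_pos hx0 _
  have hsq' : (2 : ℝ) ^ P * u ≤ ((u' : ℝ)) ^ 2 := by
    rw [Nat.shiftLeft_eq] at hsq
    have : ((u * 2 ^ P : ℕ) : ℝ) ≤ ((u' * u' : ℕ) : ℝ) := by exact_mod_cast hsq
    push_cast at this; nlinarith
  have h2 : ((2 : ℝ) ^ P * y) ^ 2 ≤ ((u' : ℝ)) ^ 2 := by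
    calc ((2 : ℝ) ^ P * y) ^ 2 = (2 : ℝ) ^ P * ((2 : ℝ) ^ P * (x : ℝ) ^ (-((2 : ℝ) ^ (0 : ℕ) / (2 : ℝ) ^ D))) := by
          rw [mul_pow, hy, rpow_half_sq hx0 D]; ring
      _ ≤ (2 : ℝ) ^ P * u := mul_le_mul_of_nonneg_left hu (by positivity)
      _ ≤ ((u' : ℝ)) ^ 2 := hsq'
  exact (pow_le_pow_iff_left₀ (by positivity) (by positivity) (by norm_num : (2 : ℕ) ≠ 0)).1 h2

/-- Length of the lower chain. [folklore] -/
private theorem length_lowChain : ∀ (k ℓ : ℕ) (acc : List ℕ), (lowChain P k ℓ acc).length = acc.length + k := by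
  intro k
  induction k with
  | zero => intro ℓ acc; rfl
  | succ k ih => intro ℓ acc; simp only [lowChain, ih, List.length_cons]; omega

/-- Length of the upper chain. [folklore] -/
private theorem length_upChain : ∀ (k u : ℕ) (acc : List ℕ), (upChain P k u acc).length = acc.length + k := by
  intro k
  induction k with
  | zero => intro u acc; rfl
  | succ k ih => intro u acc; simp only [upChain, ih, List.length_cons]; omega

/-- The lower chain preserves the lower-root property, raising the depth by `k`. [cite: Chua2005RealZeros, §2.2 ALGO 1] -/
theorem lowChain_spec (hx : 1 ≤ x) : ∀ (k D ℓ : ℕ) (lst : List ℕ), lst.getD 0 0 = ℓ → 0 < lst.length →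
    RootsLow P x D lst → RootsLow P x (D + k) (lowChain P k ℓ lst) := by
  intro k
  induction k with
  | zero => intro D ℓ lst _ _ h; simpa [lowChain] using h
  | succ k ih =>
    intro D ℓ lst h0 hlen h
    simp only [lowChain]
    set ℓ' := lowSqrt (ℓ <<< P) ((ℓ + (1 <<< P)) / 2) with hℓ'
    have hnew : RootsLow P x (D + 1) (ℓ' :: lst) := by
      intro e he
      cases e with
      | zero =>
        rw [List.getD_cons_zero]
        have hℓ : (ℓ : ℝ) ≤ (2 : ℝ) ^ P * (x : ℝ) ^ (-((2 : ℝ) ^ (0 : ℕ) / (2 : ℝ) ^ D)) := by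
          have := h 0 hlen; rwa [h0] at this
        exact low_step P hx (lowSqrt_mul_self_le _ _) hℓ
      | succ e =>
        rw [List.getD_cons_succ, two_pow_succ_div_succ]
        exact h e (by simpa using he)
    have := ih (D + 1) ℓ' (ℓ' :: lst) (by simp) (by simp) hnew
    rwa [show D + 1 + k = D + (k + 1) by omega] at this

/-- The upper chain preserves the upper-root property, raising the depth by `k`. [cite: Chua2005RealZeros, §2.2 ALGO 1] -/
theorem upChain_spec (hx : 1 ≤ x) : ∀ (k D u : ℕ) (lst : List ℕ), lst.getD 0 (1 <<< (3 * P)) = u → 0 < lst.length →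
    RootsUp P x D lst → RootsUp P x (D + k) (upChain P k u lst) := by
  intro k
  induction k with
  | zero => intro D u lst _ _ h; simpa [upChain] using h
  | succ k ih =>
    intro D u lst h0 hlen h
    simp only [upChain]
    set u' := upSqrt (u <<< P) ((u + (1 <<< P)) / 2 + 1) with hu'
    have hnew : RootsUp P x (D + 1) (u' :: lst) := by
      intro e he
      cases e with
      | zero =>
        rw [List.getD_cons_zero]
        have hu : (2 : ℝ) ^ P * (x : ℝ) ^ (-((2 : ℝ) ^ (0 : ℕ) / (2 : ℝ) ^ D)) ≤ u := by
          have := h 0 hlen; rwa [h0] at this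
        exact up_step P hx (le_upSqrt_mul_self _ _) hu
      | succ e =>
        rw [List.getD_cons_succ, two_pow_succ_div_succ]
        exact h e (by simpa using he)
    have := ih (D + 1) u' (u' :: lst) (by simp) (by simp) hnew
    rwa [show D + 1 + k = D + (k + 1) by omega] at this

/-- **Lower roots**: for `x ≥ 1`, `J ≥ 1`: `lowRoots P J x` has length `J` and entry `e` is `≤ 2^P x^{-2^e/2^J}`.
[cite: Chua2005RealZeros, §2.2 ALGO 1] -/
theorem lowRoots_spec (hx : 1 ≤ x) {J : ℕ} (hJ : 1 ≤ J) :
    (lowRoots P J x).length = J ∧ RootsLow P x J (lowRoots P J x) := by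
  refine ⟨by rw [lowRoots, length_lowChain]; simp; omega, ?_⟩
  have h1 : RootsLow P x 1 [(rootEnc x 2 P).1] := by
    intro e he
    simp only [List.length_singleton, Nat.lt_one_iff] at he
    subst he
    simp only [List.getD_cons_zero, pow_zero, pow_one]
    have := (rootEnc_spec P hx (show 1 ≤ 2 by norm_num)).1
    simpa using this
  have := lowChain_spec P hx (J - 1) 1 (rootEnc x 2 P).1 [(rootEnc x 2 P).1] rfl (by simp) h1
  rw [show 1 + (J - 1) = J by omega] at this
  exact this

/-- **Upper roots**: for `x ≥ 1`, `J ≥ 1`: `upRoots P J x` has length `J` and entry `e` is `≥ 2^P x^{-2^e/2^J}`.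
[cite: Chua2005RealZeros, §2.2 ALGO 1] -/
theorem upRoots_spec (hx : 1 ≤ x) {J : ℕ} (hJ : 1 ≤ J) :
    (upRoots P J x).length = J ∧ RootsUp P x J (upRoots P J x) := by
  refine ⟨by rw [upRoots, length_upChain]; simp; omega, ?_⟩
  have h1 : RootsUp P x 1 [(rootEnc x 2 P).2] := by
    intro e he
    simp only [List.length_singleton, Nat.lt_one_iff] at he
    subst he
    simp only [List.getD_cons_zero, pow_zero, pow_one]
    have := (rootEnc_spec P hx (show 1 ≤ 2 by norm_num)).2
    simpa using this
  have := upChain_spec P hx (J - 1) 1 (rootEnc x 2 P).2 [(rootEnc x 2 P).2] rfl (by simp) h1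
  rw [show 1 + (J - 1) = J by omega] at this
  exact this

/-! ### The chain steps -/

/-- `Nat.beq` reflects equality (Boolean form used by the kernel definitions). [folklore] -/
private theorem beq_false_ne {m n : ℕ} (h : Nat.beq m n = false) : m ≠ n := fun hmn => by
  subst hmn; simp at h

/-- Odd/even split of the step in real form: `Δ = 2 ⌊Δ/2⌋ + Δ % 2`. [folklore] -/
private theorem cast_eq_two_mul_div_add_mod (Δ : ℕ) : (Δ : ℝ) = 2 * ((Δ / 2 : ℕ) : ℝ) + ((Δ % 2 : ℕ) : ℝ) := by
  have := Nat.div_add_mod Δ 2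
  exact_mod_cast this.symm

/-- **Lower chain step.** If `roots` has the lower-root property at depth `D`, `x ≥ 1`, and `c ≤ 2^P x^{-a}`, then
`stepLo P roots fuel c Δ e ≤ 2^P x^{-(a + Δ·2^e/2^D)}`. [cite: Chua2005RealZeros, §2.2 ALGO 1] -/
theorem stepLo_le (hx : 1 ≤ x) {D : ℕ} {roots : List ℕ} (hr : RootsLow P x D roots) :
    ∀ (fuel c Δ e : ℕ) (a : ℝ), (c : ℝ) ≤ (2 : ℝ) ^ P * (x : ℝ) ^ (-a) →
      ((stepLo P roots fuel c Δ e : ℕ) : ℝ) ≤ (2 : ℝ) ^ P * (x : ℝ) ^ (-(a + (Δ : ℝ) * (2 : ℝ) ^ e / (2 : ℝ) ^ D)) := by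
  have hx0 : (0 : ℝ) < x := by exact_mod_cast hx
  intro fuel
  induction fuel with
  | zero =>
    intro c Δ e a hc
    cases Δ with
    | zero => simp only [stepLo, show Nat.beq 0 0 = true from rfl, cond_true]; simpa using hc
    | succ n =>
      simp only [stepLo, show Nat.beq (n + 1) 0 = false from rfl, cond_false, Nat.cast_zero]; positivity
  | succ fuel ih =>
    intro c Δ e a hc
    cases Δ with
    | zero => simp only [stepLo, show Nat.beq 0 0 = true from rfl, cond_true]; simpa using hc
    | succ n =>
      simp only [stepLo, show Nat.beq (n + 1) 0 = false from rfl, cond_false]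
      -- the bound on the intermediate value `c'`
      set t : ℝ := (2 : ℝ) ^ e / (2 : ℝ) ^ D with ht
      have key : ∀ c' : ℕ, (c' : ℝ) ≤ (2 : ℝ) ^ P * (x : ℝ) ^ (-(a + (((n + 1) % 2 : ℕ) : ℝ) * t)) →
          ((stepLo P roots fuel c' ((n + 1) / 2) (e + 1) : ℕ) : ℝ) ≤
            (2 : ℝ) ^ P * (x : ℝ) ^ (-(a + ((n + 1 : ℕ) : ℝ) * (2 : ℝ) ^ e / (2 : ℝ) ^ D)) := by
        intro c' hc'
        have h := ih c' ((n + 1) / 2) (e + 1) _ hc'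
        have hexp : a + ((((n + 1) % 2 : ℕ) : ℝ)) * t + (((n + 1) / 2 : ℕ) : ℝ) * (2 : ℝ) ^ (e + 1) / (2 : ℝ) ^ D =
            a + ((n + 1 : ℕ) : ℝ) * (2 : ℝ) ^ e / (2 : ℝ) ^ D := by
          rw [cast_eq_two_mul_div_add_mod (n + 1), ht, pow_succ]; ring
        rwa [hexp] at h
      cases hbit : Nat.beq ((n + 1) % 2) 1 with
      | false =>
        simp only [cond_false]
        have h0 : (n + 1) % 2 = 0 := by have := beq_false_ne hbit; omega
        refine key c ?_
        rw [h0]; simpa using hc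
      | true =>
        simp only [cond_true]
        have h1 : (n + 1) % 2 = 1 := Nat.eq_of_beq_eq_true hbit
        refine key _ ?_
        rw [h1, Nat.shiftRight_eq_div_pow]
        push_cast
        rw [one_mul]
        have hr0 : ((roots.getD e 0 : ℕ) : ℝ) ≤ (2 : ℝ) ^ P * (x : ℝ) ^ (-t) := by
          by_cases he : e < roots.length
          · exact hr e he
          · rw [List.getD_eq_default _ _ (by omega), Nat.cast_zero]; positivity
        calc (((c * roots.getD e 0) / 2 ^ P : ℕ) : ℝ) ≤ ((c * roots.getD e 0 : ℕ) : ℝ) / ((2 ^ P : ℕ) : ℝ) :=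
              Nat.cast_div_le
          _ = (c : ℝ) * ((roots.getD e 0 : ℕ) : ℝ) / (2 : ℝ) ^ P := by push_cast; ring
          _ ≤ ((2 : ℝ) ^ P * (x : ℝ) ^ (-a)) * ((2 : ℝ) ^ P * (x : ℝ) ^ (-t)) / (2 : ℝ) ^ P := by
              exact div_le_div_of_nonneg_right (mul_le_mul hc hr0 (Nat.cast_nonneg _) (by positivity)) (by positivity)
          _ = (2 : ℝ) ^ P * ((x : ℝ) ^ (-a) * (x : ℝ) ^ (-t)) := by field_simp
          _ = (2 : ℝ) ^ P * (x : ℝ) ^ (-(a + t)) := by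
              rw [← Real.rpow_add hx0]; ring_nf

/-- Rounding up a fixed-point product: `A/2^P ≤ (A + (2^P − 1)) >>> P`. [folklore] -/
private theorem div_le_shiftRight_ceil (A P : ℕ) :
    (A : ℝ) / (2 : ℝ) ^ P ≤ (((A + ((1 <<< P) - 1)) >>> P : ℕ) : ℝ) := by
  rw [Nat.shiftRight_eq_div_pow, Nat.one_shiftLeft]
  have hpos : 0 < 2 ^ P := Nat.two_pow_pos P
  have h := Nat.div_add_mod (A + (2 ^ P - 1)) (2 ^ P)
  have hlt := Nat.mod_lt (A + (2 ^ P - 1)) hpos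
  have hA : A ≤ 2 ^ P * ((A + (2 ^ P - 1)) / 2 ^ P) := by omega
  rw [div_le_iff₀ (by positivity)]
  have : (A : ℝ) ≤ ((2 ^ P * ((A + (2 ^ P - 1)) / 2 ^ P) : ℕ) : ℝ) := by exact_mod_cast hA
  push_cast at this
  linarith

/-- **Upper chain step.** If `roots` has the upper-root property at depth `D`, `x ≥ 1`, `a ≥ 0` and `2^P x^{-a} ≤ c`, then
`2^P x^{-(a + Δ·2^e/2^D)} ≤ stepHi P roots fuel c Δ e`. [cite: Chua2005RealZeros, §2.2 ALGO 1] -/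
theorem le_stepHi (hx : 1 ≤ x) {D : ℕ} {roots : List ℕ} (hr : RootsUp P x D roots) :
    ∀ (fuel c Δ e : ℕ) (a : ℝ), 0 ≤ a → (2 : ℝ) ^ P * (x : ℝ) ^ (-a) ≤ c →
      (2 : ℝ) ^ P * (x : ℝ) ^ (-(a + (Δ : ℝ) * (2 : ℝ) ^ e / (2 : ℝ) ^ D)) ≤ ((stepHi P roots fuel c Δ e : ℕ) : ℝ) := by
  have hx0 : (0 : ℝ) < x := by exact_mod_cast hx
  have hx1 : (1 : ℝ) ≤ x := by exact_mod_cast hx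
  -- the fallback value dominates every target
  have hbig : ∀ (s : ℝ), 0 ≤ s → (2 : ℝ) ^ P * (x : ℝ) ^ (-s) ≤ (((1 <<< (3 * P)) : ℕ) : ℝ) := by
    intro s hs
    rw [Nat.one_shiftLeft]; push_cast
    have h1 : (x : ℝ) ^ (-s) ≤ 1 := Real.rpow_le_one_of_one_le_of_nonpos hx1 (by linarith)
    have h2 : (2 : ℝ) ^ P ≤ (2 : ℝ) ^ (3 * P) := pow_le_pow_right₀ (by norm_num) (by omega)
    calc (2 : ℝ) ^ P * (x : ℝ) ^ (-s) ≤ (2 : ℝ) ^ P * 1 := mul_le_mul_of_nonneg_left h1 (by positivity)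
      _ ≤ (2 : ℝ) ^ (3 * P) := by rw [mul_one]; exact h2
  intro fuel
  induction fuel with
  | zero =>
    intro c Δ e a ha hc
    cases Δ with
    | zero => simp only [stepHi, show Nat.beq 0 0 = true from rfl, cond_true]; simpa using hc
    | succ n =>
      simp only [stepHi, show Nat.beq (n + 1) 0 = false from rfl, cond_false]
      exact hbig _ (by positivity)
  | succ fuel ih =>
    intro c Δ e a ha hc
    cases Δ with
    | zero => simp only [stepHi, show Nat.beq 0 0 = true from rfl, cond_true]; simpa using hc
    | succ n =>
      simp only [stepHi, show Nat.beq (n + 1) 0 = false from rfl, cond_false]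
      set t : ℝ := (2 : ℝ) ^ e / (2 : ℝ) ^ D with ht
      have ht0 : 0 ≤ t := by positivity
      have key : ∀ c' : ℕ, (2 : ℝ) ^ P * (x : ℝ) ^ (-(a + (((n + 1) % 2 : ℕ) : ℝ) * t)) ≤ c' →
          (2 : ℝ) ^ P * (x : ℝ) ^ (-(a + ((n + 1 : ℕ) : ℝ) * (2 : ℝ) ^ e / (2 : ℝ) ^ D)) ≤
            ((stepHi P roots fuel c' ((n + 1) / 2) (e + 1) : ℕ) : ℝ) := by
        intro c' hc'
        have h := ih c' ((n + 1) / 2) (e + 1) _ (by positivity) hc'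
        have hexp : a + ((((n + 1) % 2 : ℕ) : ℝ)) * t + (((n + 1) / 2 : ℕ) : ℝ) * (2 : ℝ) ^ (e + 1) / (2 : ℝ) ^ D =
            a + ((n + 1 : ℕ) : ℝ) * (2 : ℝ) ^ e / (2 : ℝ) ^ D := by
          rw [cast_eq_two_mul_div_add_mod (n + 1), ht, pow_succ]; ring
        rwa [hexp] at h
      cases hbit : Nat.beq ((n + 1) % 2) 1 with
      | false =>
        simp only [cond_false]
        have h0 : (n + 1) % 2 = 0 := by have := beq_false_ne hbit; omega
        refine key c ?_
        rw [h0]; simpa using hc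
      | true =>
        simp only [cond_true]
        have h1 : (n + 1) % 2 = 1 := Nat.eq_of_beq_eq_true hbit
        refine key _ ?_
        rw [h1]
        push_cast
        rw [one_mul]
        have hr0 : (2 : ℝ) ^ P * (x : ℝ) ^ (-t) ≤ ((roots.getD e (1 <<< (3 * P)) : ℕ) : ℝ) := by
          by_cases he : e < roots.length
          · exact hr e he
          · rw [List.getD_eq_default _ _ (by omega)]; exact hbig t ht0
        calc (2 : ℝ) ^ P * (x : ℝ) ^ (-(a + t)) = ((2 : ℝ) ^ P * (x : ℝ) ^ (-a)) * ((2 : ℝ) ^ P * (x : ℝ) ^ (-t)) / (2 : ℝ) ^ P := by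
              rw [neg_add, Real.rpow_add hx0]; field_simp
          _ ≤ (c : ℝ) * ((roots.getD e (1 <<< (3 * P)) : ℕ) : ℝ) / (2 : ℝ) ^ P := by
              exact div_le_div_of_nonneg_right (mul_le_mul hc hr0 (by positivity) (Nat.cast_nonneg _)) (by positivity)
          _ = ((c * roots.getD e (1 <<< (3 * P)) : ℕ) : ℝ) / (2 : ℝ) ^ P := by push_cast; ring
          _ ≤ _ := div_le_shiftRight_ceil _ _

end Specs

end LTruncationPacked

end Literature.NumberTheory.LFunctions
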